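import Summits.QuantumFields.QCD.Theses.QuarksAsStableAction
import Summits.QuantumFields.QCD.Theses.WilsonQuarkChessboard
import Summits.QuantumFields.QCD.Theorems.QuarksAsStableActionWilsonQuarkStabilityStubFreeTwistedFourier
import Summits.QuantumFields.QCD.Theorems.QuarksAsStableActionWilsonQuarkStabilityStubAPLatticeSum
import Summits.QuantumFields.QCD.Theorems.QuarksAsStableActionWilsonQuarkStabilityStubFreeTangentBound
import Summits.QuantumFields.QCD.Theorems.QuarksAsStableActionWilsonQuarkStabilityStubCellGauge
import Summits.QuantumFields.QCD.Theorems.QuarksAsStableActionWilsonQuarkStabilityStubTilingStability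
import Summits.QuantumFields.QCD.Theorems.QuarksAsStableActionWilsonQuarkStabilityStubTransferEven

/-!
# `QuarkChessboard → WilsonQuarkStability on even tori` (line `Sketch`, idea `free-tangent-landau-chessboard`,
crux `Summit.QuantumFields.QCD.Theses.QuarksAsStableAction.WilsonQuarkStability`, item stmt-QuantumFields-9736)

The sorry-free composition of the six landed stubs of the line: the quark chessboard of the sibling route
(`WilsonQuarkChessboard.QuarkChessboard`, item stmt-QuantumFields-9306, OPEN — taken as the hypothesis) implies the
crux `WilsonQuarkStability` VERBATIM with `Even L →` inserted after `L₀ ≤ L →`.  Chain: Fourier diagonalisation of the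
free twisted Wilson–Dirac operator (stub 1) + antiperiodic `d = 4` lattice sum (stub 2) ⇒ THEOREM A, the free-tangent
bound (stub 3) ; + cell gauge fixing on `Q₄` (stub 4) ⇒ stability of period-2 reflection tilings (stub 5) ; + the
chessboard ⇒ the even-`L` crux (stub 6).  What separates this from the crux as typed: the hypothesis (9306) and odd `L`
(reflection tilings need even side) — the line's registered stub 7.
-/

namespace Summit.QuantumFields.QCD.Cruxes.WilsonQuarkStability.FreeTangentLandauChessboard

/-- **The quark chessboard implies Wilson-quark stability on even tori** (crux `WilsonQuarkStability` of route
QuarksAsStableAction with `Even L →` inserted; hypothesis = crux `QuarkChessboard` of route WilsonQuarkChessboard,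
item stmt-QuantumFields-9306, as typed). -/
theorem stub_evenOfQuarkChessboard :
    Summit.QuantumFields.QCD.Theses.WilsonQuarkChessboard.QuarkChessboard →
      ∃ ε δ K c₂ C : ℝ, 0 < ε ∧ 0 < δ ∧ ∃ L₀ : ℕ, ∀ (L : ℕ) [NeZero L], L₀ ≤ L → Even L →
        ∀ m : ℝ, |m| ≤ ε → ∀ U : Literature.MathematicalPhysics.QuantumFieldTheory.GaugeConfig 4 L (Matrix.specialUnitaryGroup (Fin 3) ℂ),
          ‖Literature.MathematicalPhysics.QuantumLattice.fermionDet (Literature.MathematicalPhysics.QuantumLattice.wilsonDirac (Literature.MathematicalPhysics.QuantumLattice.unitaryFundamentalRep (Fin 3) ℂ) (fun e => if e.1 e.2 = -1 then -(⟨(U e).1, Matrix.specialUnitaryGroup_le_unitaryGroup (U e).2⟩ : Matrix.unitaryGroup (Fin 3) ℂ) else ⟨(U e).1, Matrix.specialUnitaryGroup_le_unitaryGroup (U e).2⟩) m 1)‖ ≤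
            Real.exp (K + c₂ * (∑ p ∈ Finset.univ.filter (fun p : Literature.MathematicalPhysics.QuantumFieldTheory.Plaquette 4 L => (3 - (Literature.MathematicalPhysics.QuantumLattice.fundamentalRep (Fin 3) (Literature.MathematicalPhysics.QuantumFieldTheory.plaquetteHolonomy U p.1 p.2.1.1 p.2.1.2)).trace.re) < δ), (3 - (Literature.MathematicalPhysics.QuantumLattice.fundamentalRep (Fin 3) (Literature.MathematicalPhysics.QuantumFieldTheory.plaquetteHolonomy U p.1 p.2.1.1 p.2.1.2)).trace.re)) +
              C * ((Finset.univ.filter (fun p : Literature.MathematicalPhysics.QuantumFieldTheory.Plaquette 4 L => δ ≤ (3 - (Literature.MathematicalPhysics.QuantumLattice.fundamentalRep (Fin 3) (Literature.MathematicalPhysics.QuantumFieldTheory.plaquetteHolonomy U p.1 p.2.1.1 p.2.1.2)).trace.re))).card : ℝ)) *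
            ‖Literature.MathematicalPhysics.QuantumLattice.fermionDet (Literature.MathematicalPhysics.QuantumLattice.wilsonDirac (Literature.MathematicalPhysics.QuantumLattice.unitaryFundamentalRep (Fin 3) ℂ) (fun e => if e.1 e.2 = -1 then -(⟨((1 : Literature.MathematicalPhysics.QuantumFieldTheory.GaugeConfig 4 L (Matrix.specialUnitaryGroup (Fin 3) ℂ)) e).1, Matrix.specialUnitaryGroup_le_unitaryGroup ((1 : Literature.MathematicalPhysics.QuantumFieldTheory.GaugeConfig 4 L (Matrix.specialUnitaryGroup (Fin 3) ℂ)) e).2⟩ : Matrix.unitaryGroup (Fin 3) ℂ) else ⟨((1 : Literature.MathematicalPhysics.QuantumFieldTheory.GaugeConfig 4 L (Matrix.specialUnitaryGroup (Fin 3) ℂ)) e).1, Matrix.specialUnitaryGroup_le_unitaryGroup ((1 : Literature.MathematicalPhysics.QuantumFieldTheory.GaugeConfig 4 L (Matrix.specialUnitaryGroup (Fin 3) ℂ)) e).2⟩) m 1)‖ :=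
  fun hQC => stub_transferEven
    (stub_tilingStability_of (stub_freeTangentBound_of stub_freeTwistedFourier stub_apLatticeSum) stub_cellGauge)
    hQC

end Summit.QuantumFields.QCD.Cruxes.WilsonQuarkStability.FreeTangentLandauChessboard
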